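import Mathlib
import Summits.KontsevichZagierPeriods.Zeta5Search.BrickClassDenominators
import Summits.KontsevichZagierPeriods.Zeta5Search.BrickDenominators

/-!
# BrickSingleClassDenominators — for ODD `s` each single residue class `k ≡ a (mod p)` carries the Krattenthaler–Rivoal
exponent: `ord_p Σ_{k ≤ n, k ≡ a (p)} c_{k,s}(n) ≥ −⌊log_p n⌋·(A−1−s)` (cell zeta5-irr)

HONEST FRAMING: systematic search; no irrationality claim unless certified. INSTRUMENT corollary of the ζ(5)
census cell zeta5-irr (HOME `run/shared/lean/pub/zeta5-irr/`), filed by the engine seat zi-eng (g12) at the referee's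
request (zi-ref R6.35 note n1: the docstring remark of `BrickClassDenominators` «for odd s … each SINGLE class carries the
bound» is now a theorem). Nothing here is about ζ(5); no denominator saving beyond print; 0 nats/n; rung F-Z1 NOT moved.

## The statement (`p` odd prime, `A` even, `1 ≤ B`, `2B ≤ A`, kernel `R_n^{(A,B,1)}`, `s` ODD)

* `cell_reflect_odd`: `c_{n−K,s}(n) = c_{K,s}(n)` for odd `s ≤ A` (Krattenthaler–Rivoal's reciprocity (eq:recipari) read on
  the cells, `KrattenthalerRivoal2007.IsPartialFractionData.reflect` + `BrickDenominators.isPartialFractionData_cell`).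
* `classSum_reflect`: `Σ_{k≤n, k ≡ n−a} c_{k,s}(n) = Σ_{k≤n, k ≡ a} c_{k,s}(n)` (odd `s ≤ A`).
* **`padicValuation_singleClassSum_le`**: for every residue `a` and odd `s`,
  `v(Σ_{k≤n, k ≡ a (p)} c_{k,s}(n)) ≤ exp(⌊log_p n⌋·(A−1−s))` — from the class-PAIR theorem
  `BrickClassDenominators.padicValuation_classSum_le`: the pair sum is the single sum (if `2a ≡ n`) or twice it, and
  `2` is a `p`-adic unit; for `s > A` the cells are top cells, integral termwise.
-/

namespace Summit.KontsevichZagierPeriods.Zeta5Search.BrickSingleClassDenominators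

open Finset Nat WithZero
open Summit.KontsevichZagierPeriods.Zeta5Search.BrickLaurent (cell)
open Summit.KontsevichZagierPeriods.Zeta5Search.BrickTopKummer (cell_one_valuation_abs)
open Summit.KontsevichZagierPeriods.Zeta5Search.BrickLambda (padicValuation_two)
open Summit.KontsevichZagierPeriods.Zeta5Search.BrickClassDenominators (padicValuation_classSum_le)
open Summit.KontsevichZagierPeriods.Zeta5Search.BrickDenominators (isPartialFractionData_cell)
open Literature.NumberTheory.Irrationality.KrattenthalerRivoal2007 (IsPartialFractionData.reflect)

noncomputable section

variable {p : ℕ} [Fact p.Prime]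

/-- **Reflection of the cells for odd `s`**: `c_{n−K,s}(n) = c_{K,s}(n)` (`A` even, `2B ≤ A`, `1 < A`, odd `s ≤ A`). -/
theorem cell_reflect_odd {A B : ℕ} (hA : Even A) (hAB : 2 * B ≤ A) (h1A : 1 < A) {n K : ℕ} (hK : K ≤ n) {s : ℕ}
    (hs : Odd s) (hsA : s ≤ A) : cell A B 1 n (n - K) s = cell A B 1 n K s := by
  have hs1 : 1 ≤ s := hs.pos
  have h := (isPartialFractionData_cell hAB h1A n).reflect (o := s - 1) (by omega) hK
  rw [Nat.sub_add_cancel hs1] at h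
  have h1 : ((-1 : ℚ)) ^ (A * (n + 1) + 1) = -1 := by
    rw [pow_succ, (hA.mul_right (n + 1)).neg_one_pow]; norm_num
  rw [h, h1, hs.neg_one_pow]
  ring

/-- **The reflected class has the same sum** (odd `s ≤ A`): `Σ_{k≤n, k ≡ n−a (p)} c_{k,s}(n) = Σ_{k≤n, k ≡ a (p)} c_{k,s}(n)`. -/
theorem classSum_reflect {A B : ℕ} (hA : Even A) (hAB : 2 * B ≤ A) (h1A : 1 < A) (n : ℕ) {s : ℕ} (hs : Odd s)
    (hsA : s ≤ A) (a : ZMod p) :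
    ∑ j ∈ (range (n + 1)).filter (fun j : ℕ => (j : ZMod p) = (n : ZMod p) - a), cell A B 1 n j s =
      ∑ j ∈ (range (n + 1)).filter (fun j : ℕ => (j : ZMod p) = a), cell A B 1 n j s := by
  rw [Finset.sum_filter, Finset.sum_filter, ← Finset.sum_range_reflect (fun j => if ((j : ℕ) : ZMod p) = (n : ZMod p) - a
    then cell A B 1 n j s else 0) (n + 1)]
  refine Finset.sum_congr rfl fun j hj => ?_
  have hjn : j ≤ n := by have := mem_range.1 hj; omega
  rw [show n + 1 - 1 - j = n - j by omega, cell_reflect_odd hA hAB h1A hjn hs hsA, Nat.cast_sub hjn]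
  have hiff : ((n : ZMod p) - j = n - a) ↔ ((j : ZMod p) = a) := by
    constructor
    · intro h; exact sub_right_injective h
    · intro h; rw [h]
  simp only [hiff]

/-- **Each SINGLE residue class carries the Krattenthaler–Rivoal exponent for odd `s`**: for every odd prime `p`, every
`n`, every residue `a` and every ODD `s`: `v(Σ_{k≤n, k ≡ a (p)} c_{k,s}(n)) ≤ exp(⌊log_p n⌋·(A−1−s))`. -/
theorem padicValuation_singleClassSum_le (hp2 : p ≠ 2) {A B : ℕ} (hA : Even A) (hB : 1 ≤ B) (hAB : 2 * B ≤ A)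
    (n s : ℕ) (hs : Odd s) (a : ZMod p) :
    Rat.padicValuation p (∑ j ∈ (range (n + 1)).filter (fun j : ℕ => (j : ZMod p) = a), cell A B 1 n j s) ≤
      exp ((Nat.log p n : ℤ) * ((A - 1 - s : ℕ) : ℤ)) := by
  have hp : p.Prime := Fact.out
  have h1A : 1 < A := by omega
  rcases Nat.lt_or_ge A s with hsA | hsA
  · -- `s > A`: top cells, integral termwise, and the exponent is `0`
    rw [show (A - 1 - s : ℕ) = 0 by omega, Nat.cast_zero, mul_zero, exp_zero]
    refine Valuation.map_sum_le _ fun j hj => ?_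
    have hjn : j ≤ n := by have := mem_range.1 (mem_filter.1 hj).1; omega
    have h := cell_one_valuation_abs hp2 hAB (L := Nat.log p n) (Nat.lt_pow_succ_log_self hp.one_lt n) hjn s
    rwa [show (A - s : ℕ) = 0 by omega, Nat.cast_zero, mul_zero, exp_zero] at h
  · have hpair := padicValuation_classSum_le hp2 hA hB hAB n s a
    by_cases hc : (n : ZMod p) - a = a
    · -- the class is its own reflection: the pair IS the single class
      have hfilter : (range (n + 1)).filter (fun j : ℕ => (j : ZMod p) = a ∨ (j : ZMod p) = (n : ZMod p) - a) =
          (range (n + 1)).filter (fun j : ℕ => (j : ZMod p) = a) := by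
        refine Finset.filter_congr fun j _ => ?_
        rw [hc, or_self]
      rwa [hfilter] at hpair
    · -- two distinct classes with equal sums: the pair sum is twice the single sum
      have hdisj : Disjoint ((range (n + 1)).filter (fun j : ℕ => (j : ZMod p) = a))
          ((range (n + 1)).filter (fun j : ℕ => (j : ZMod p) = (n : ZMod p) - a)) := by
        rw [Finset.disjoint_filter]
        intro j _ h1 h2
        exact hc (h2.symm.trans h1)
      have hsplit : ∑ j ∈ (range (n + 1)).filter (fun j : ℕ => (j : ZMod p) = a ∨ (j : ZMod p) = (n : ZMod p) - a),
          cell A B 1 n j s = 2 * ∑ j ∈ (range (n + 1)).filter (fun j : ℕ => (j : ZMod p) = a), cell A B 1 n j s := by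
        rw [Finset.filter_or, Finset.sum_union hdisj, classSum_reflect hA hAB h1A n hs hsA a, two_mul]
      rw [hsplit, map_mul, padicValuation_two hp2, one_mul] at hpair
      exact hpair

end

end Summit.KontsevichZagierPeriods.Zeta5Search.BrickSingleClassDenominators
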